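import Summits.QuantumFields.YangMills.Theorems.BalabanUVNodesN18RunWindowEdge

/-!
# BalabanUVNodes ∕ N18 — THE U3 → U2 EDGE IN RUN-WINDOW CURRENCY, RECORD EDITION: at def-W1's objects, at the kernels of record `objectsOfRecord₁₃`, and UNDER K3's READING PIN
# (`(𝔯.lit …).u3 = objectsOfRecord₁₃ …`, the N18 ∕ (D4) carriers of `PHolderD4`) — the RUN-WINDOW KERNEL STEP RATE OF RECORD + the (D4) binder `ReadOutAt` ⟹ dag-n17-w1's
# run-window N17 text for the datum's β; and K3's current box conjunct `N18At` is STRONGER than the new hypothesis (by name)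
# (Track A, DAG node N18 = NE5 → N17; key K3⁸ `SpineGivenEndpointR13SepCoPHV` = stmt-QuantumFields-27366, skeleton v6 b4e55110ab73e679; width seat `pub-ymgap-dag-n18-w1` g6, FILE 4 —
# record edition of FILE 3 `…N18RunWindowEdge` p630396)

HONEST FRAMING.  Count-neutral kernel bookkeeping BY NAME (`--kind proof --supports stmt-QuantumFields-27366 --as helper`): FILE 3's `runWindowShift_of_readOutAt_ne5AtRunWindows` ∕
`runWindowKernelStepRate_of_kernelStepRate` instantiated at node U3's bundles `u3OfRecord₁₃ θ u k` (dag-n17-a ∕ n22 `…RateCarriersOfRecord13(CoPH)`, faces `rfl`), at W1-19's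
`objectsOfRecord₁₃` and under the reading pin, with g2's `n18At_rateCarriers_of_kernels_pin_iff_letter` for the comparison with K3's box conjunct.  The RUN-WINDOW KERNEL STEP RATE
(N18's η-rate asked only along the in-window (0.20)-runs of the datum's β, first coupling = the run's own `g_j`; NE5 NOT PRINTED for d = 4), the (D4) binder `ReadOutAt` and the runs'
window-stability `Step.InInterval` are DISPLAYED HYPOTHESES; nothing of Bałaban's is asserted, inhabited, discharged or refuted; N17 ∕ N18 NOT discharged; K3⁸ OPEN (v6), no stub proved ∕
refuted, NO skeleton re-keyed (R-N18-RUN remains a located input, evidence #20 on 27366); K3⁷ 20544 aside.  Counts UNMOVED (typed 28∕28 · discharged 5∕27, A 5∕28).  One finite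
four-torus programme at fixed `ε`, Bałaban AS PRINTED; route R4 closes ONLY the conditional finite-𝕋⁴ rung `BalabanLadder.UV` — NOT the continuum limit, NOT ℝ⁴, NOT OS, NOT the
Yang–Mills mass gap, NOT Clay.  THEOREMS ONLY: 0 `def`, 0 `instance`, 0 `sorry`, standard axioms.

WHAT (theorems only).  §4 ★★ `runWindowShift_of_readOutAt_objects_runWindowKernelStepRate` (generic `ℰ`, bundle `u3OfRecord₁₃ θ (objects F ℰ ρ bV ℓ) k`: `ReadOutAt D u` + the run-window
kernel step rate of `ℰ` along `D.βfun`'s in-window runs ⟹ the run-window N17 text for `D.βfun`, `a_k = ℓ.cr·ℓ.C₅·ℓ.θ₅·ℓ.θ₅^k`) · `runWindowKernelStepRate_of_n18At_objects` (K3's box conjunct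
`N18At` at the bundle ⟹ the run-window kernel letter: the new hypothesis is WEAKER) · ★★ `runWindowShift_of_readOutAt_objectsOfRecord₁₃_runWindowKernelStepRate` (at the kernels of
record) · `runWindowKernelStepRateOfRecord₁₃_of_kernelStepRateOfRecord₁₃`.  §5 under the reading pin: ★★ `runWindowShift_of_readOutAt_pin_runWindowKernelStepRate` (`ReadOutAt D
(rateCarriersOfRecord₁₃CoPH 𝔯 F θ hP g₀ os k).u3` — the (D4) binder of `PHolderD4` at the bundle of record — + `hpin` + the run-window kernel letter of record ⟹ run-window N17 for
`D.βfun`) · `runWindowKernelStepRate_of_n18At_pin` (K3's current N18 conjunct at the pinned bundle ⟹ the run-window kernel letter of record).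

References (TYPES ∕ locators only): [Balaban1987RG1] CMP **109** (1987): (0.18)–(0.20) pp. 255–256, Thm 1 p. 259 (NE5 NOT printed), (1.20)–(1.22) p. 264, §5 p. 298.
-/

noncomputable section

open scoped BigOperators

namespace YMDAG.N18.RunWindowEdge

open Literature.MathematicalPhysics.QuantumFieldTheory.Balaban1983to89
open Literature.MathematicalPhysics.QuantumFieldTheory.Balaban1983to89.T4Continuum (T4Family ULoop)
open Literature.MathematicalPhysics.QuantumFieldTheory.Balaban1983to89.T4OutputRate (Window NE5)
open Literature.MathematicalPhysics.QuantumFieldTheory.Balaban1983to89.FlowStep (Box HBeta mem_box prefixOf prefixOf_apply RGEqH)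
open Literature.MathematicalPhysics.QuantumFieldTheory.Balaban1983to89.T4FlagMemory (extd)
open Literature.MathematicalPhysics.QuantumFieldTheory.Balaban1983to89.T4BetaReadOut (extd_mem_window)
open Literature.MathematicalPhysics.QuantumFieldTheory.Balaban1983to89.Node00 (TermFamily1 prependCoupling U3Letters₁₁ Stage13Params Stage13HParams)
open Literature.MathematicalPhysics.QuantumFieldTheory.Balaban1983to89.Node00.U3OfKernels (kernelA EA EB pt carriers objects objectsOfRecord₁₃)
open Literature.MathematicalPhysics.QuantumFieldTheory.Balaban1983to89.Node00.U3KernelLetters (KernelStepRate KernelStepRateOfRecord₁₃)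
open Literature.MathematicalPhysics.QuantumFieldTheory.Balaban1983to89.B12Sec2to5 (l1)
open YMDAG.N18.AtRecordOfKernelLetters (n18At_u3OfRecord₁₃_objects_iff_kernelStepRate_letter n18At_rateCarriers_of_kernels_pin_iff_letter)
open YMDAG.UVSplit

/-! ## §4 At node U3's bundles `u3OfRecord₁₃ θ (objects F ℰ ρ bV ℓ) k` (generic term family) and at the kernels of record `objectsOfRecord₁₃` -/

section Objects

open scoped Matrix.Norms.L2Operator

variable {𝔄 : Type*} [NormedRing 𝔄] [NormedAlgebra ℝ 𝔄]
variable {V : Type*} [NormedAddCommGroup V] [NormedSpace ℝ V] {ι : Type*} [Fintype ι]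
variable (F : T4Family) (ℰ : TermFamily1 F 𝔄) (ρ : V →L[ℝ] 𝔄) (bV : Module.Basis ι ℝ V)
variable {N : ℕ} [NeZero N]

/-- ★★ **AT THE BUNDLE `u3OfRecord₁₃ θ (objects F ℰ ρ bV ℓ) k`: (D4) + THE RUN-WINDOW KERNEL STEP RATE ⟹ RUN-WINDOW N17 FOR THE DATUM's β.**  `ReadOutAt D u` at node U3's bundle of def-W1's
objects (the binder K3's `PHolderD4` carries) and N18's η-rate asked ONLY along the in-window (0.20)-runs of `D.βfun` — `|Π_{k+1}(g_{j+1}, …; z) − Π_{k+2}(g_j, g_{j+1}, …; z)| ≤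
ℓ.C₅·ℓ.θ₅^{k+1}e^{−ℓ.κ|z|₁}`, first coupling = the run's own `g_j` — give dag-n17-w1's run-window N17 text for `D.βfun` with `a_k = ℓ.cr·ℓ.C₅·ℓ.θ₅·ℓ.θ₅^k` (FILE 3
`runWindowShift_of_readOutAt_ne5AtRunWindows`; the bundle's faces are `rfl`).  No box quantifier on N18's side. [cite: Balaban1987RG1, (0.18)–(0.20) pp.255–256, (1.20)–(1.22) p.264, Thm 1 p.259] -/
theorem runWindowShift_of_readOutAt_objects_runWindowKernelStepRate (θ : Stage13Params F N) (ℓ : U3Letters₁₁) (kk : ℕ) (D : Datum F N)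
    (hD4 : ReadOutAt D (u3OfRecord₁₃ θ (objects F ℰ ρ bV ℓ) kk))
    (h18run : ∀ (n : ℕ) (gs : ℕ → ℝ), RGEqH n D.βfun gs → Step.InInterval θ.γ n gs → ∀ j k : ℕ, j + (k + 1) ≤ n → ∀ (μ ν : Fin 4) (z : Fin 4 → ℤ),
      |kernelA F ℰ ρ bV (fun i => gs (j + 1 + i)) k μ ν z - kernelA F ℰ ρ bV (fun i => gs (j + i)) (k + 1) μ ν z| ≤ ℓ.C₅ * ℓ.θ₅ ^ (k + 1) * Real.exp (-(ℓ.κ * l1 z))) :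
    ∀ (n : ℕ) (gs : ℕ → ℝ), RGEqH n D.βfun gs → Step.InInterval θ.γ n gs → ∀ j k : ℕ, j + (k + 1) ≤ n →
      |D.βfun (k + 1) (prefixOf (fun i => gs (j + i)) (k + 1)) - D.βfun k (prefixOf (fun i => gs (j + 1 + i)) k)| ≤ ℓ.cr * ℓ.C₅ * ℓ.θ₅ * ℓ.θ₅ ^ k :=
  runWindowShift_of_readOutAt_ne5AtRunWindows D hD4 (by
    rintro n gs hR hI j k hjk U ⟨k', μ, ν, z⟩ hX
    change carriers.scale (k', μ, ν, z) = k + 1 at hX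
    have hk' : k' = k := by simpa using hX
    subst hk'
    show |kernelA F ℰ ρ bV (extd (prefixOf (fun i => gs (j + 1 + i)) k')) k' μ ν z -
        kernelA F ℰ ρ bV (prependCoupling (gs j) (extd (prefixOf (fun i => gs (j + 1 + i)) k'))) (k' + 1) μ ν z| ≤ ℓ.C₅ * ℓ.θ₅ ^ (k' + 1) * Real.exp (-(ℓ.κ * l1 z))
    rw [kernelA_extd_prefixOf_shift, kernelA_prepend_extd_prefixOf_shift]
    exact h18run n gs hR hI j k' hjk μ ν z)

/-- **K3's CURRENT BOX CONJUNCT IS STRONGER**: `N18At (u3OfRecord₁₃ θ (objects F ℰ ρ bV ℓ) k)` (⟺ W1-21's box letter `KernelStepRate … θ.γ ℓ.κ ℓ.θ₅ ℓ.C₅`, g2) ⟹ the run-window kernel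
step rate along the in-window runs of ANY `β` (FILE 3 `runWindowKernelStepRate_of_kernelStepRate`). [cite: Balaban1987RG1, Thm 1 p.259 and (1.21) p.264] -/
theorem runWindowKernelStepRate_of_n18At_objects (θ : Stage13Params F N) (ℓ : U3Letters₁₁) (kk : ℕ) (β : HBeta)
    (h18 : N18At (u3OfRecord₁₃ θ (objects F ℰ ρ bV ℓ) kk)) :
    ∀ (n : ℕ) (gs : ℕ → ℝ), RGEqH n β gs → Step.InInterval θ.γ n gs → ∀ j k : ℕ, j + (k + 1) ≤ n → ∀ (μ ν : Fin 4) (z : Fin 4 → ℤ),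
      |kernelA F ℰ ρ bV (fun i => gs (j + 1 + i)) k μ ν z - kernelA F ℰ ρ bV (fun i => gs (j + i)) (k + 1) μ ν z| ≤ ℓ.C₅ * ℓ.θ₅ ^ (k + 1) * Real.exp (-(ℓ.κ * l1 z)) :=
  runWindowKernelStepRate_of_kernelStepRate F ℰ ρ bV ((n18At_u3OfRecord₁₃_objects_iff_kernelStepRate_letter F ℰ ρ bV θ ℓ kk).1 h18)

variable (N)

/-- ★★ **AT THE KERNELS OF RECORD** `objectsOfRecord₁₃ F N θ ℓ` (W1-19): (D4) at the bundle of record + THE RUN-WINDOW KERNEL STEP RATE OF RECORD (the letter stated through the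
objects' run-A functional, `(objectsOfRecord₁₃ …).EA 0 g · (pt k μ ν z) = Π_{k+1}(g; μν z)` of the merged term of record) ⟹ the run-window N17 text for the datum's β.
[cite: Balaban1987RG1, (0.18)–(0.20) pp.255–256, (1.20)–(1.22) p.264, Thm 1 p.259] -/
theorem runWindowShift_of_readOutAt_objectsOfRecord₁₃_runWindowKernelStepRate (θ : Stage13Params F N) (ℓ : U3Letters₁₁) (kk : ℕ) (D : Datum F N)
    (hD4 : ReadOutAt D (u3OfRecord₁₃ θ (objectsOfRecord₁₃ F N θ ℓ) kk))
    (h18run : ∀ (n : ℕ) (gs : ℕ → ℝ), RGEqH n D.βfun gs → Step.InInterval θ.γ n gs → ∀ j k : ℕ, j + (k + 1) ≤ n → ∀ (μ ν : Fin 4) (z : Fin 4 → ℤ),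
      |(objectsOfRecord₁₃ F N θ ℓ).EA 0 (fun i => gs (j + 1 + i)) PUnit.unit (pt k μ ν z) -
          (objectsOfRecord₁₃ F N θ ℓ).EA 0 (fun i => gs (j + i)) PUnit.unit (pt (k + 1) μ ν z)| ≤ ℓ.C₅ * ℓ.θ₅ ^ (k + 1) * Real.exp (-(ℓ.κ * l1 z))) :
    ∀ (n : ℕ) (gs : ℕ → ℝ), RGEqH n D.βfun gs → Step.InInterval θ.γ n gs → ∀ j k : ℕ, j + (k + 1) ≤ n →
      |D.βfun (k + 1) (prefixOf (fun i => gs (j + i)) (k + 1)) - D.βfun k (prefixOf (fun i => gs (j + 1 + i)) k)| ≤ ℓ.cr * ℓ.C₅ * ℓ.θ₅ * ℓ.θ₅ ^ k := by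
  letI := θ.instVβ₁; letI := θ.instVβ₂; letI := θ.instιβ
  have hD4' : ReadOutAt D (u3OfRecord₁₃ θ
      (objects F (Node00.mergedTermFamilyMatT F N (Node00.TβOfRecord₁₃ F N) (Node00.chiβOfRecord₁₃ F N θ) θ.εbg) θ.ρ8 θ.bV ℓ) kk) := hD4
  have h18' : ∀ (n : ℕ) (gs : ℕ → ℝ), RGEqH n D.βfun gs → Step.InInterval θ.γ n gs → ∀ j k : ℕ, j + (k + 1) ≤ n → ∀ (μ ν : Fin 4) (z : Fin 4 → ℤ),
      |kernelA F (Node00.mergedTermFamilyMatT F N (Node00.TβOfRecord₁₃ F N) (Node00.chiβOfRecord₁₃ F N θ) θ.εbg) θ.ρ8 θ.bV (fun i => gs (j + 1 + i)) k μ ν z -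
          kernelA F (Node00.mergedTermFamilyMatT F N (Node00.TβOfRecord₁₃ F N) (Node00.chiβOfRecord₁₃ F N θ) θ.εbg) θ.ρ8 θ.bV (fun i => gs (j + i)) (k + 1) μ ν z| ≤
        ℓ.C₅ * ℓ.θ₅ ^ (k + 1) * Real.exp (-(ℓ.κ * l1 z)) :=
    fun n gs hR hI j k hjk μ ν z => h18run n gs hR hI j k hjk μ ν z
  exact runWindowShift_of_readOutAt_objects_runWindowKernelStepRate F _ θ.ρ8 θ.bV θ ℓ kk D hD4' h18'

/-- At the record, the BOX letter of record `KernelStepRateOfRecord₁₃ F N θ ℓ.κ ℓ.θ₅ ℓ.C₅` ⟹ the run-window kernel letter of record along the in-window runs of ANY `β` (the letter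
R-N18-RUN names is WEAKER than today's). [cite: Balaban1987RG1, Thm 1 p.259 and (1.21) p.264] -/
theorem runWindowKernelStepRateOfRecord₁₃_of_kernelStepRateOfRecord₁₃ (θ : Stage13Params F N) (ℓ : U3Letters₁₁) (β : HBeta)
    (h18 : KernelStepRateOfRecord₁₃ F N θ ℓ.κ ℓ.θ₅ ℓ.C₅) :
    ∀ (n : ℕ) (gs : ℕ → ℝ), RGEqH n β gs → Step.InInterval θ.γ n gs → ∀ j k : ℕ, j + (k + 1) ≤ n → ∀ (μ ν : Fin 4) (z : Fin 4 → ℤ),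
      |(objectsOfRecord₁₃ F N θ ℓ).EA 0 (fun i => gs (j + 1 + i)) PUnit.unit (pt k μ ν z) -
          (objectsOfRecord₁₃ F N θ ℓ).EA 0 (fun i => gs (j + i)) PUnit.unit (pt (k + 1) μ ν z)| ≤ ℓ.C₅ * ℓ.θ₅ ^ (k + 1) * Real.exp (-(ℓ.κ * l1 z)) := by
  letI := θ.instVβ₁; letI := θ.instVβ₂; letI := θ.instιβ
  have h := runWindowKernelStepRate_of_kernelStepRate F
    (Node00.mergedTermFamilyMatT F N (Node00.TβOfRecord₁₃ F N) (Node00.chiβOfRecord₁₃ F N θ) θ.εbg) θ.ρ8 θ.bV (β := β) h18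
  exact fun n gs hR hI j k hjk μ ν z => h n gs hR hI j k hjk μ ν z

end Objects

/-! ## §5 Under K3's reading pin `(𝔯.lit F θ hP g₀ os).u3 = objectsOfRecord₁₃ F N θ ℓ` (the `U3PinnedKernels` clause at one tuple): the N18 ∕ (D4) carriers of `PHolderD4` -/

section Pin

open scoped Matrix.Norms.L2Operator

variable (F : T4Family) {N : ℕ} [NeZero N]

/-- ★★ **UNDER THE PIN: (D4) AT THE BUNDLE OF RECORD + THE RUN-WINDOW KERNEL LETTER OF RECORD ⟹ RUN-WINDOW N17 FOR THE DATUM's β.**  With `hpin` (K3's `U3PinnedKernels 𝔯 ℓ'`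
at the tuple, `ℓ := ℓ' F θ`), the (D4) binder `ReadOutAt D (rateCarriersOfRecord₁₃CoPH 𝔯 F θ hP g₀ os k).u3` — literally the second conjunct of `PHolderD4 β D (rrOfRecord 𝔯 ksel
F θ hP g₀ os)` at `k := ksel …` — and N18's η-rate along the in-window runs of `D.βfun` through the kernels of record give dag-n17-w1's run-window N17 text for `D.βfun`,
`a_k = ℓ.cr·ℓ.C₅·ℓ.θ₅·ℓ.θ₅^k` — WITHOUT the box conjunct `N18At`.  The producer shape R-N18-RUN asks of node N18, delivered to the K2 ∕ K3 roads in their own text.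
[cite: Balaban1987RG1, (0.18)–(0.20) pp.255–256, (1.20)–(1.22) p.264, Thm 1 p.259] -/
theorem runWindowShift_of_readOutAt_pin_runWindowKernelStepRate (𝔯 : RateReading₁₃CoPH N) (θ : Stage13HParams F N) (hP : θ.Provisos₁₃CoPH F N)
    (g₀ : ℕ → ℝ) (os : List (ULoop F)) (ℓ : U3Letters₁₁) (hpin : (𝔯.lit F θ hP g₀ os).u3 = objectsOfRecord₁₃ F N θ.toStage13Params ℓ) (kk : ℕ) (D : Datum F N)
    (hD4 : ReadOutAt D (rateCarriersOfRecord₁₃CoPH 𝔯 F θ hP g₀ os kk).u3)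
    (h18run : ∀ (n : ℕ) (gs : ℕ → ℝ), RGEqH n D.βfun gs → Step.InInterval θ.γ n gs → ∀ j k : ℕ, j + (k + 1) ≤ n → ∀ (μ ν : Fin 4) (z : Fin 4 → ℤ),
      |(objectsOfRecord₁₃ F N θ.toStage13Params ℓ).EA 0 (fun i => gs (j + 1 + i)) PUnit.unit (pt k μ ν z) -
          (objectsOfRecord₁₃ F N θ.toStage13Params ℓ).EA 0 (fun i => gs (j + i)) PUnit.unit (pt (k + 1) μ ν z)| ≤ ℓ.C₅ * ℓ.θ₅ ^ (k + 1) * Real.exp (-(ℓ.κ * l1 z))) :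
    ∀ (n : ℕ) (gs : ℕ → ℝ), RGEqH n D.βfun gs → Step.InInterval θ.γ n gs → ∀ j k : ℕ, j + (k + 1) ≤ n →
      |D.βfun (k + 1) (prefixOf (fun i => gs (j + i)) (k + 1)) - D.βfun k (prefixOf (fun i => gs (j + 1 + i)) k)| ≤ ℓ.cr * ℓ.C₅ * ℓ.θ₅ * ℓ.θ₅ ^ k := by
  have hD4' : ReadOutAt D (u3OfRecord₁₃ θ.toStage13Params (objectsOfRecord₁₃ F N θ.toStage13Params ℓ) kk) := by
    have e : (rateCarriersOfRecord₁₃CoPH 𝔯 F θ hP g₀ os kk).u3 = u3OfRecord₁₃ θ.toStage13Params (𝔯.lit F θ hP g₀ os).u3 kk := rfl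
    rw [e, hpin] at hD4
    exact hD4
  exact runWindowShift_of_readOutAt_objectsOfRecord₁₃_runWindowKernelStepRate F N θ.toStage13Params ℓ kk D hD4' h18run

/-- **K3's CURRENT N18 CONJUNCT AT THE PINNED BUNDLE IS STRONGER**: `N18At (rateCarriersOfRecord₁₃CoPH 𝔯 F θ hP g₀ os k).u3` (⟺ `KernelStepRateOfRecord₁₃`, g2's
`n18At_rateCarriers_of_kernels_pin_iff_letter`) ⟹ the run-window kernel letter of record along the in-window runs of ANY `β`.  So re-keying N18 per R-N18-RUN only WEAKENS what stub 1's
witness must supply; FILE 1 says the box form is the presumptively dead part under F-E. [cite: Balaban1987RG1, Thm 1 p.259 and (1.21) p.264] -/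
theorem runWindowKernelStepRate_of_n18At_pin (𝔯 : RateReading₁₃CoPH N) (θ : Stage13HParams F N) (hP : θ.Provisos₁₃CoPH F N) (g₀ : ℕ → ℝ) (os : List (ULoop F))
    (ℓ : U3Letters₁₁) (hpin : (𝔯.lit F θ hP g₀ os).u3 = objectsOfRecord₁₃ F N θ.toStage13Params ℓ) (kk : ℕ) (β : HBeta)
    (h18 : N18At (rateCarriersOfRecord₁₃CoPH 𝔯 F θ hP g₀ os kk).u3) :
    ∀ (n : ℕ) (gs : ℕ → ℝ), RGEqH n β gs → Step.InInterval θ.γ n gs → ∀ j k : ℕ, j + (k + 1) ≤ n → ∀ (μ ν : Fin 4) (z : Fin 4 → ℤ),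
      |(objectsOfRecord₁₃ F N θ.toStage13Params ℓ).EA 0 (fun i => gs (j + 1 + i)) PUnit.unit (pt k μ ν z) -
          (objectsOfRecord₁₃ F N θ.toStage13Params ℓ).EA 0 (fun i => gs (j + i)) PUnit.unit (pt (k + 1) μ ν z)| ≤ ℓ.C₅ * ℓ.θ₅ ^ (k + 1) * Real.exp (-(ℓ.κ * l1 z)) :=
  runWindowKernelStepRateOfRecord₁₃_of_kernelStepRateOfRecord₁₃ F N θ.toStage13Params ℓ β ((n18At_rateCarriers_of_kernels_pin_iff_letter F 𝔯 θ hP g₀ os ℓ hpin kk).1 h18)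

end Pin

end YMDAG.N18.RunWindowEdge
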